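import Literature.NumberTheory.Automorphic.SymPowIwahoriCoefficients
import Literature.NumberTheory.Automorphic.LevelActionCoefficientTensor
import Literature.NumberTheory.Automorphic.IwahoriUpCrossPlace
import Literature.NumberTheory.Automorphic.BianchiWeightModule
import Mathlib.RingTheory.PiTensorProduct
import HarnessLib

/-!
# Independence of weight for tensor products `⨂_j Sym^{m_j}(S²)` (all places above `p` at once)

Topic `NumberTheory/Automorphic`; namespace `Literature.NumberTheory.Automorphic.IntegralWeightGL2`;
definitions with bodies and theorems.  The multi-factor version of `SymPowIwahoriCoefficients`
(the `GL₂` one-place instance of the change-of-coefficients machinery of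
`LevelActionCoefficientChange`), for the coefficients `M_𝛌 = ⊗_τ M_{λ_τ}` of `Res_{F/ℚ} GL₂`
([KhareThorne2017, §6.4, Prop. 6.13]; [Hida1994AIF, §2, Prop. 2.1]): a finite family of factors
`j ∈ J` (the embeddings `τ`), each with a place `v j ∣ p`, a reduction `red j : 𝒪_{v j} → S` and a
weight `m j`.

* `multiIwahoriMonoid v red = ⋂_j iwahoriMonoid K (v j) (red j)`, `inclAt j`;
* `symPowCoeffJ` — the action `⊗_j symPowCoeff` on the tree's `SymPowTensor S J m = ⨂_j Sym^{m_j}(S²)`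
  (`BianchiWeightModule`); `lowCharJ` — the product character `∏_j χ_{m_j}` on `S`
  (`⨂_j S(χ_j) = S(∏_j χ_j)`); `coeffX₁J = ∏_j λ₁(·_j)` (i.e. `⊗_j λ₁` followed by multiplication
  `⨂_j S ≅ S`), `smulX₁powJ c = c · ⊗_j X₁^{m_j}`;
* the three hypotheses, factorwise (`LevelActionCoefficientTensor`): `coeffX₁J_comp_symPowCoeffJ`
  (equivariance), `coeffX₁J_comp_smulX₁powJ` (splitting), `heckeFactorsThroughJ` (factorisation
  along `U α U` whenever the first column of `red_j(α_{v j})` vanishes for EVERY `j`);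
* `upElement_mem_multiIwahoriMonoid`, `redMatrix_upElement_col_zero` — the element
  `α = ∏_{w ∈ s} t_{w,1}^r` (`IwahoriUpCrossPlace.upElement`), `s ⊇ {v j}`, is contracting at every
  factor when `red_j(ϖ_{v j})^r = 0`;
* **`independenceOfWeight_bijOn_tensor`** — the abstract independence of weight for
  `U_p^{(r)} = [U (∏_w t_w^r) U]`: `(⊗_j λ₁)_*` is a bijection between parts exchanged with `Θ` on
  which `U_p^{(r)}` is injective, resp. surjective.

## References

* C. Khare, J. A. Thorne, Amer. J. Math. 139 (2017), §6.4, Prop. 6.13 (arXiv:1409.7007, held).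
  [KhareThorne2017]
* H. Hida, Ann. Inst. Fourier 44 (1994), §2, Prop. 2.1 (held). [Hida1994AIF]
-/

noncomputable section

open scoped TensorProduct
open PiTensorProduct IsDedekindDomain NumberField

namespace Literature.NumberTheory.Automorphic.IntegralWeightGL2

open BigHeckeGLn LevelAction

variable (K : Type) [Field K] [NumberField K] {S : Type} [CommRing S] {J : Type}
  (v : J → HeightOneSpectrum (𝓞 K)) (red : ∀ j : J, (v j).adicCompletionIntegers K →+* S)

/-! ### The multi-place Iwahori monoid -/

/-- **`⋂_j iwahoriMonoid K (v j) (red j)`**: finite-adelic matrices in the Iwahori monoid at every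
factor's place. [cite: KhareThorne2017, §6.4] -/
def multiIwahoriMonoid : Submonoid (FiniteAdelicGL 2 K) :=
  ⨅ j : J, iwahoriMonoid K (v j) (red j)

variable {K v red} in
/-- Membership in the multi-place Iwahori monoid. [folklore] -/
theorem mem_multiIwahoriMonoid_iff {g : FiniteAdelicGL 2 K} :
    g ∈ multiIwahoriMonoid K v red ↔ ∀ j, g ∈ iwahoriMonoid K (v j) (red j) := by
  rw [multiIwahoriMonoid, Submonoid.mem_iInf]

/-- The inclusion into the `j`-th Iwahori monoid. [folklore] -/
def inclAt (j : J) : multiIwahoriMonoid K v red →* iwahoriMonoid K (v j) (red j) where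
  toFun g := ⟨g, mem_multiIwahoriMonoid_iff.1 g.2 j⟩
  map_one' := rfl
  map_mul' _ _ := rfl

variable {K v red} in
/-- Unfolding `inclAt`. [folklore] -/
@[simp]
theorem coe_inclAt (j : J) (g : multiIwahoriMonoid K v red) :
    (inclAt K v red j g : FiniteAdelicGL 2 K) = g :=
  rfl

variable {K v red} in
/-- A level inside the multi-place Iwahori monoid lies in each factor's Iwahori monoid. [folklore] -/
theorem le_iwahoriMonoid_of_le_multi {U : Subgroup (FiniteAdelicGL 2 K)}
    (hU : U.toSubmonoid ≤ multiIwahoriMonoid K v red) (j : J) :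
    U.toSubmonoid ≤ iwahoriMonoid K (v j) (red j) := fun _ hu =>
  mem_multiIwahoriMonoid_iff.1 (hU hu) j

/-! ### The coefficient modules `⨂_j Sym^{m_j}(S²)` and `S(∏_j χ_{m_j})` -/

variable (m : J → ℕ)

/-- **`⊗_j symPowCoeff`** on `SymPowTensor S J m = ⨂_j Sym^{m_j}(S²)`.
[cite: KhareThorne2017, §6.4 (M_𝛌 = ⊗_τ M_{λ_τ})] -/
def symPowCoeffJ : multiIwahoriMonoid K v red →* Module.End S (SymPowTensor S J m) :=
  show multiIwahoriMonoid K v red →* Module.End S (⨂[S] j : J, SymPow S (m j)) from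
    tensorAction (multiIwahoriMonoid K v red) fun j => (symPowCoeff K (v j) (red j) (m j)).comp (inclAt K v red j)

variable {K v red} in
/-- `symPowCoeffJ` on pure tensors is factorwise. [folklore] -/
theorem symPowCoeffJ_apply_tprod (g : multiIwahoriMonoid K v red) (x : ∀ j, SymPow S (m j)) :
    symPowCoeffJ K v red m g (SymPowTensor.tprod x) =
      SymPowTensor.tprod fun j => symPowCoeff K (v j) (red j) (m j) (inclAt K v red j g) (x j) :=
  tensorAction_apply_tprod _ _ g x

/-- **`ψ : S → ⨂_j Sym^{m_j}(S²)`, `c ↦ c · ⊗_j X₁^{m_j}`.** [cite: KhareThorne2017, §6.4 (α_𝛌)] -/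
def smulX₁powJ (S : Type) [CommRing S] (m : J → ℕ) : S →ₗ[S] SymPowTensor S J m :=
  LinearMap.toSpanSingleton S _ (SymPowTensor.tprod fun j => X₁pow S (m j))

/-- Unfolding lemma for `smulX₁powJ`. [folklore] -/
@[simp]
theorem smulX₁powJ_apply (S : Type) [CommRing S] (m : J → ℕ) (c : S) :
    smulX₁powJ S m c = c • SymPowTensor.tprod fun j => X₁pow S (m j) :=
  rfl

variable {K} in
/-- `redMatrix` depends only on the local component. [folklore] -/
theorem redMatrix_eq_of_localComponent_eq {w : HeightOneSpectrum (𝓞 K)}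
    {red' : w.adicCompletionIntegers K →+* S} {g g' : iwahoriMonoid K w red'}
    (h : localComponent 2 K w (g : FiniteAdelicGL 2 K) = localComponent 2 K w (g' : FiniteAdelicGL 2 K))
    (i j : Fin 2) : redMatrix K w red' g i j = redMatrix K w red' g' i j := by
  rw [redMatrix_apply, redMatrix_apply]
  congr 1
  exact Subtype.ext (by rw [coe_toIntMatrix_localInt_apply, coe_toIntMatrix_localInt_apply, h])

variable {K} in
/-- Membership in the Iwahori monoid depends only on the local component. [folklore] -/
theorem mem_iwahoriMonoid_of_localComponent_eq {w : HeightOneSpectrum (𝓞 K)}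
    {red' : w.adicCompletionIntegers K →+* S} {g g' : FiniteAdelicGL 2 K}
    (h : localComponent 2 K w g = localComponent 2 K w g') (hg' : g' ∈ iwahoriMonoid K w red') :
    g ∈ iwahoriMonoid K w red' := by
  rw [mem_iwahoriMonoid_iff, h]
  exact hg'

/-! ### The element `U_p^{(r)} = ∏_{w ∈ s} t_{w,1}^r` -/

variable {K} in
/-- The component at `w ∈ s` of `∏_{v ∈ s} t_v^r` is that of `t_w^r`. [folklore] -/
theorem localComponent_upElement_of_mem {s : Finset (HeightOneSpectrum (𝓞 K))} {r : ℕ}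
    {w : HeightOneSpectrum (𝓞 K)} (hw : w ∈ s) :
    localComponent 2 K w (TameLevel.upElement (K := K) s r) = localComponent 2 K w (heckeElement 2 K w 1 ^ r) := by
  classical
  rw [TameLevel.upElement, ← Finset.insert_erase hw,
    Finset.noncommProd_insert_of_notMem _ _ _ _ (Finset.notMem_erase w s), map_mul,
    ← TameLevel.upElement, TameLevel.localComponent_upElement_of_not_mem (Finset.notMem_erase w s), mul_one]

/-- **`∏_{w ∈ s} t_w^r` lies in the multi-place Iwahori monoid** when every `v j ∈ s`. [folklore] -/
theorem upElement_mem_multiIwahoriMonoid {s : Finset (HeightOneSpectrum (𝓞 K))} (hs : ∀ j, v j ∈ s)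
    (r : ℕ) : TameLevel.upElement (K := K) s r ∈ multiIwahoriMonoid K v red :=
  mem_multiIwahoriMonoid_iff.2 fun j =>
    mem_iwahoriMonoid_of_localComponent_eq (localComponent_upElement_of_mem (hs j))
      (heckeElement_pow_mem_iwahoriMonoid K (v j) (red j) r)

variable {K v red} in
/-- **The first column of `red_j((∏_w t_w^r)_{v j}) = diag(red_j(ϖ_{v j})^r, 1)` vanishes** when
`red_j(ϖ_{v j})^r = 0` and `v j ∈ s`. [folklore] -/
theorem redMatrix_upElement_col_zero {s : Finset (HeightOneSpectrum (𝓞 K))} (hs : ∀ j, v j ∈ s)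
    (r : ℕ) (hr : ∀ j, red j ⟨_, uniformizerAt_mem_adicCompletionIntegers K (v j)⟩ ^ r = 0) (j : J)
    (i : Fin 2) :
    redMatrix K (v j) (red j) ⟨TameLevel.upElement (K := K) s r,
      mem_multiIwahoriMonoid_iff.1 (upElement_mem_multiIwahoriMonoid K v red hs r) j⟩ i 0 = 0 := by
  rw [redMatrix_eq_of_localComponent_eq (g' := ⟨heckeElement 2 K (v j) 1 ^ r,
    heckeElement_pow_mem_iwahoriMonoid K (v j) (red j) r⟩) (localComponent_upElement_of_mem (hs j))]
  exact redMatrix_heckeElement_pow_col_zero K (v j) (red j) r (hr j) i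

/-! ### The product character and `∏_j λ₁` (finite `J`) -/

section FintypeJ

variable [Fintype J]

/-- **The product character `∏_j χ_{m_j}`**, `χ_{m_j}(g) = red_j((g_{v j})₁₁)^{m_j}`.
[cite: KhareThorne2017, §6.4] -/
def lowCharFunJ : multiIwahoriMonoid K v red →* S :=
  ∏ j : J, (lowCharFun K (v j) (red j) (m j)).comp (inclAt K v red j)

/-- Unfolding `lowCharFunJ`. [folklore] -/
theorem lowCharFunJ_apply (g : multiIwahoriMonoid K v red) :
    lowCharFunJ K v red m g = ∏ j : J, redMatrix K (v j) (red j) (inclAt K v red j g) 1 1 ^ (m j) := by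
  rw [lowCharFunJ, MonoidHom.finsetProd_apply]
  rfl

/-- **The coefficients `S(∏_j χ_{m_j})`** (`= ⨂_j S(χ_{m_j})`): `S` with the multi-place Iwahori
monoid acting through the product character. [cite: KhareThorne2017, §6.4] -/
def lowCharJ : multiIwahoriMonoid K v red →* Module.End S S :=
  (algebraMap S (Module.End S S) : S →+* Module.End S S).toMonoidHom.comp (lowCharFunJ K v red m)

/-- Unfolding lemma: `(∏χ)(g) c = (∏_j red_j((g_{v j})₁₁)^{m_j}) c`. [folklore] -/
@[simp]
theorem lowCharJ_apply (g : multiIwahoriMonoid K v red) (c : S) :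
    lowCharJ K v red m g c = lowCharFunJ K v red m g * c := by
  change (algebraMap S (Module.End S S) (lowCharFunJ K v red m g)) c = _
  rw [Module.algebraMap_end_apply, smul_eq_mul]

/-- **`∏_j λ₁`: `⨂_j Sym^{m_j}(S²) → S`**, `⊗_j x_j ↦ ∏_j λ₁(x_j)` (`⊗_j λ₁` followed by the
multiplication `⨂_j S ≅ S`, `PiTensorProduct.constantBaseRingEquiv`).
[cite: KhareThorne2017, §6.4 (β_𝛌)] -/
def coeffX₁J (S : Type) [CommRing S] (m : J → ℕ) : SymPowTensor S J m →ₗ[S] S :=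
  show (⨂[S] j : J, SymPow S (m j)) →ₗ[S] S from
    (constantBaseRingEquiv J S).toLinearEquiv.toLinearMap ∘ₗ PiTensorProduct.map fun j => coeffX₁ S (m j)

/-- `coeffX₁J` on pure tensors. [folklore] -/
@[simp]
theorem coeffX₁J_tprod (S : Type) [CommRing S] (m : J → ℕ) (x : ∀ j, SymPow S (m j)) :
    coeffX₁J S m (SymPowTensor.tprod x) = ∏ j, coeffX₁ S (m j) (x j) := by
  change constantBaseRingEquiv J S
    (PiTensorProduct.map (fun j => coeffX₁ S (m j)) (PiTensorProduct.tprod S x)) = _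
  rw [PiTensorProduct.map_tprod, constantBaseRingEquiv_tprod]

/-! ### The three hypotheses -/

variable {K v red}

/-- **`∏_j λ₁` is equivariant `⨂_j Sym^{m_j}(S²) → S(∏_j χ_{m_j})`.**
[cite: KhareThorne2017, §6.4, proof of Prop. 6.13] -/
theorem coeffX₁J_comp_symPowCoeffJ (δ : multiIwahoriMonoid K v red) :
    coeffX₁J S m ∘ₗ symPowCoeffJ K v red m δ = lowCharJ K v red m δ ∘ₗ coeffX₁J S m := by
  refine SymPowTensor.hom_ext fun x => ?_
  rw [LinearMap.comp_apply, LinearMap.comp_apply, symPowCoeffJ_apply_tprod, coeffX₁J_tprod,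
    coeffX₁J_tprod, lowCharJ_apply, lowCharFunJ_apply, ← Finset.prod_mul_distrib]
  refine Finset.prod_congr rfl fun j _ => ?_
  have h := LinearMap.congr_fun (coeffX₁_comp_symPowCoeff (m j) (inclAt K v red j δ)) (x j)
  rw [LinearMap.comp_apply, LinearMap.comp_apply, lowChar_apply] at h
  exact h

/-- **`(∏_j λ₁) ∘ ψ = id`.** [folklore] -/
theorem coeffX₁J_comp_smulX₁powJ (S : Type) [CommRing S] (m : J → ℕ) :
    coeffX₁J S m ∘ₗ smulX₁powJ S m = LinearMap.id := by
  refine LinearMap.ext_ring ?_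
  rw [LinearMap.comp_apply, smulX₁powJ_apply, one_smul, coeffX₁J_tprod, LinearMap.id_apply]
  refine Finset.prod_eq_one fun j _ => ?_
  have h := LinearMap.congr_fun (coeffX₁_comp_smulX₁pow S (m j)) (1 : S)
  rw [LinearMap.comp_apply, smulX₁pow_apply, one_smul, LinearMap.id_apply] at h
  exact h

/-- **The factorisation hypothesis `HeckeFactorsThrough` for `(⨂_j Sym^{m_j}(S²), ∏λ₁, ψ)` along
`U α U`**, whenever the first column of `red_j(α_{v j})` vanishes for every `j`:
`y · (∏_j λ₁(x_j)) ⊗_j X₁^{m_j} = ⊗_j λ₁(x_j) (y · X₁^{m_j}) = ⊗_j y · x_j` factorwise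
(`symPowCoeff_comp_smulX₁pow_comp_coeffX₁`). [cite: KhareThorne2017, §6.4, proof of Prop. 6.13] -/
theorem heckeFactorsThroughJ {U : Subgroup (FiniteAdelicGL 2 K)}
    (hU : U.toSubmonoid ≤ multiIwahoriMonoid K v red) {α : FiniteAdelicGL 2 K}
    (hα : α ∈ multiIwahoriMonoid K v red)
    (hα0 : ∀ j (i : Fin 2), redMatrix K (v j) (red j) ⟨α, mem_multiIwahoriMonoid_iff.1 hα j⟩ i 0 = 0) :
    HeckeFactorsThrough (multiIwahoriMonoid K v red) (symPowCoeffJ K v red m) U (coeffX₁J S m)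
      (smulX₁powJ S m) α := by
  intro y hy hyd
  refine SymPowTensor.hom_ext fun x => ?_
  rw [LinearMap.comp_apply, LinearMap.comp_apply, coeffX₁J_tprod, smulX₁powJ_apply, map_smul,
    symPowCoeffJ_apply_tprod, symPowCoeffJ_apply_tprod]
  have hj : ∀ j, symPowCoeff K (v j) (red j) (m j) (inclAt K v red j ⟨y, hy⟩) (x j) =
      coeffX₁ S (m j) (x j) • symPowCoeff K (v j) (red j) (m j) (inclAt K v red j ⟨y, hy⟩) (X₁pow S (m j)) :=
    fun j => by
      have h := LinearMap.congr_fun (symPowCoeff_comp_smulX₁pow_comp_coeffX₁ (m j)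
        (redMatrix_apply_zero_eq_zero_of_mem_doubleCosetQuot (le_iwahoriMonoid_of_le_multi hU j)
          (mem_multiIwahoriMonoid_iff.1 hα j) (hα0 j) (mem_multiIwahoriMonoid_iff.1 hy j) hyd 0)) (x j)
      rw [LinearMap.comp_apply, LinearMap.comp_apply, smulX₁pow_apply, map_smul] at h
      exact h.symm
  rw [show (fun j => symPowCoeff K (v j) (red j) (m j) (inclAt K v red j ⟨y, hy⟩) (x j)) =
      fun j => coeffX₁ S (m j) (x j) •
        symPowCoeff K (v j) (red j) (m j) (inclAt K v red j ⟨y, hy⟩) (X₁pow S (m j)) from funext hj]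
  exact ((PiTensorProduct.tprod S).map_smul_univ _ _).symm

/-! ### Independence of weight (abstract form) for `U_p^{(r)}` -/

/-- **Independence of weight for `⨂_j Sym^{m_j}(S²)` and `U_p^{(r)} = [U (∏_{w ∈ s} t_w^r) U]`,
abstract form**: for a level `U` inside the multi-place Iwahori monoid, `s ⊇ {v j}` and `r` with
`red_j(ϖ_{v j})^r = 0` for all `j`, on parts `X₀ ⊆ H^i(U, ⨂_j Sym^{m_j}(S²))`,
`Y₀ ⊆ H^i(U, ⨂_j S(χ_{m_j}))` exchanged by `(⊗λ₁)_*` and `Θ` and on which `U_p^{(r)}` is injective,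
resp. surjective, `(⊗λ₁)_* : X₀ → Y₀` is a bijection. [cite: KhareThorne2017, §6.4, Prop. 6.13]
[cite: Hida1994AIF, §2, Prop. 2.1] -/
theorem independenceOfWeight_bijOn_tensor {Γ : Type} [Group Γ] (ι : Γ →* FiniteAdelicGL 2 K)
    {U : Subgroup (FiniteAdelicGL 2 K)} (hU : U.toSubmonoid ≤ multiIwahoriMonoid K v red)
    {s : Finset (HeightOneSpectrum (𝓞 K))} (hs : ∀ j, v j ∈ s) (r : ℕ)
    (hr : ∀ j, red j ⟨_, uniformizerAt_mem_adicCompletionIntegers K (v j)⟩ ^ r = 0) (i : ℕ)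
    {X₀ : Set (cohomology ι (multiIwahoriMonoid K v red) (symPowCoeffJ K v red m) U i)}
    {Y₀ : Set (cohomology ι (multiIwahoriMonoid K v red) (lowCharJ K v red m) U i)}
    (hB : Set.MapsTo (pushforwardCohomology ι (multiIwahoriMonoid K v red) (symPowCoeffJ K v red m)
      (lowCharJ K v red m) U (coeffX₁J S m) (coeffX₁J_comp_symPowCoeffJ m) i).hom X₀ Y₀)
    (hA : Set.MapsTo (raiseCohomology ι (multiIwahoriMonoid K v red) (symPowCoeffJ K v red m)
      (lowCharJ K v red m) U (smulX₁powJ S m) (TameLevel.upElement s r) (coeffX₁J S m)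
      (coeffX₁J_comp_symPowCoeffJ m) (coeffX₁J_comp_smulX₁powJ S m) hU
      (upElement_mem_multiIwahoriMonoid K v red hs r)
      (heckeFactorsThroughJ m hU (upElement_mem_multiIwahoriMonoid K v red hs r)
        (redMatrix_upElement_col_zero hs r hr)) i).hom Y₀ X₀)
    (hinj : Set.InjOn (heckeCohomology ι (multiIwahoriMonoid K v red) (symPowCoeffJ K v red m) U hU
      (upElement_mem_multiIwahoriMonoid K v red hs r) i) X₀)
    (hsurj : Set.SurjOn (heckeCohomology ι (multiIwahoriMonoid K v red) (lowCharJ K v red m) U hU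
      (upElement_mem_multiIwahoriMonoid K v red hs r) i) Y₀ Y₀) :
    Set.BijOn (pushforwardCohomology ι (multiIwahoriMonoid K v red) (symPowCoeffJ K v red m)
      (lowCharJ K v red m) U (coeffX₁J S m) (coeffX₁J_comp_symPowCoeffJ m) i).hom X₀ Y₀ :=
  bijOn_pushforwardCohomology ι _ _ _ U _ _ _ _ _ hU _ _ i hB hA hinj hsurj

end FintypeJ

end Literature.NumberTheory.Automorphic.IntegralWeightGL2
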